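import Mathlib
import HarnessLib
import Literature.Probability.MarkovChains.CommuteTimeIdentity
import Literature.Probability.MarkovChains.RegularGraphDiameter

/-!
# The commute time of random walk on a regular graph: `t_{a↔b} ≤ 3n² − nd` (Levin–Peres–Wilmer Prop. 10.16 (b))

HONEST FRAMING: exact (Metropolis-corrected) sampling algorithms for lattice gauge theory; figures
of merit are autocorrelation/cost numbers at stated couplings and volumes; no continuum-physics claim.

Source: D. A. Levin, Y. Peres (with E. L. Wilmer), *Markov Chains and Mixing Times*, 2nd ed.,
AMS 2017 [LevinPeres2017], §10.3 PROPOSITION 10.16 (b) (p. 134) and its proof: "For a regular graph …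
`diam ≤ 3n/d − 1` … Part (b) then follows again from Proposition 10.7."  Built on
`CommuteTimeIdentity.lean` (Prop. 10.7 `t_{a↔b} = c_G R(a ↔ b)`, `R(a ↔ b) ≤ ρ·length` along a walk,
Prop. 10.16 (a)) and `RegularGraphDiameter.lean` (`(d+1)(diam+1) ≤ 3n`).  Everything is PROVED
(0 named facts, 0 definitions).

* `totalConductance_adjMatrix_regular` — `c_G = nd` for unit conductances on a `d`-regular graph;
* `effectiveResistance_adjMatrix_le_dist` — `R(a ↔ b) ≤ d(a,b)` ("Since `R(a ↔ b) ≤ diam`");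
* **PROPOSITION 10.16 (b)** `LevinPeres2017_prop_10_16_b` — `t_{a↔b} ≤ 3n² − nd` for the simple
  random walk on a connected `d`-regular graph with `n ≥ 2` vertices
  [cite: LevinPeres2017, §10.3 Prop. 10.16 (b)].

Context (cell pub-lqcd): regular move graphs (e.g. single-site update graphs of spin / link
configurations) get a uniform commute-time bound quadratic in the number of configurations.
-/

namespace Literature.Probability.MarkovChains

open Finset Matrix SimpleGraph

section RegularCommute

variable {V : Type*} [Fintype V] [DecidableEq V] {G : SimpleGraph V} [DecidableRel G.Adj]

omit [DecidableEq V] in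
/-- For unit conductances on a `d`-regular graph `c_G = Σ_x deg(x) = nd`. [cite: LevinPeres2017, §10.3,
proof of Prop. 10.16 (b) (Prop. 10.7 with `c_G = 2|E| = nd`)] -/
theorem totalConductance_adjMatrix_regular {d : ℕ} (hreg : G.IsRegularOfDegree d) :
    totalConductance (G.adjMatrix ℝ) = (Fintype.card V : ℝ) * d := by
  rw [totalConductance_def]
  simp_rw [nodeConductance_adjMatrix, hreg.degree_eq]
  rw [sum_const, card_univ, nsmul_eq_mul]

/-- For simple random walk on a connected simple graph, **`R(a ↔ b) ≤ d(a,b)`** (unit resistances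
along a shortest path; Cor. 10.8). [cite: LevinPeres2017, §10.3, proof of Prop. 10.16 ("Since
`R(a ↔ b) ≤ diam`")] -/
theorem effectiveResistance_adjMatrix_le_dist [Nontrivial V] (hconn : G.Connected) (a b : V) :
    effectiveResistance (G.adjMatrix ℝ) a b ≤ G.dist a b := by
  have hc := isConductance_adjMatrix (degree_pos_of_connected hconn)
  have hirr : IsIrreducible (networkKernel (G.adjMatrix ℝ)) := by
    rw [networkKernel_adjMatrix]
    exact srwKernel_isIrreducible_iff.2 hconn.preconnected
  obtain ⟨p, hp⟩ := hconn.exists_walk_length_eq_dist a b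
  have hG : ∀ u v, G.Adj u v → 0 < G.adjMatrix ℝ u v ∧ 1 / G.adjMatrix ℝ u v ≤ (1 : ℝ) := by
    intro u v huv
    rw [adjMatrix_apply, if_pos huv]
    norm_num
  have h1 := effectiveResistance_le_mul_length hc hirr hG p
  rw [one_mul, hp] at h1
  exact h1

/-- **PROPOSITION 10.16 (b): for random walk on a (connected) `d`-regular graph on `n` vertices,
`t_{a↔b} ≤ 3n² − nd` for all `a, b`** — `t_{a↔b} = R(a ↔ b)·nd` (Prop. 10.7), `R(a ↔ b) ≤ diam` and
`diam ≤ 3n/d − 1`. [cite: LevinPeres2017, §10.3 Prop. 10.16 (b)] -/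
theorem LevinPeres2017_prop_10_16_b [Nontrivial V] {d : ℕ} (hreg : G.IsRegularOfDegree d)
    (hconn : G.Connected) {h : V → V → ℝ} (hh : IsHittingTimeSolution (srwKernel G) h) (a b : V) :
    commuteTime h a b ≤ 3 * (Fintype.card V : ℝ) ^ 2 - (Fintype.card V : ℝ) * d := by
  have hc := isConductance_adjMatrix (degree_pos_of_connected hconn)
  have hirr : IsIrreducible (networkKernel (G.adjMatrix ℝ)) := by
    rw [networkKernel_adjMatrix]
    exact srwKernel_isIrreducible_iff.2 hconn.preconnected
  have hh' : IsHittingTimeSolution (networkKernel (G.adjMatrix ℝ)) h := by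
    rw [networkKernel_adjMatrix]; exact hh
  have hd : 1 ≤ d := by
    obtain ⟨x⟩ := (inferInstance : Nonempty V)
    have := degree_pos_of_connected hconn x
    rw [hreg.degree_eq] at this
    exact this
  rw [LevinPeres2017_prop_10_7 hc hirr hh' a b, totalConductance_adjMatrix_regular hreg, mul_comm]
  have hR := effectiveResistance_adjMatrix_le_dist hconn a b
  have hD := LevinPeres2017_prop_10_16_b_diam_real hd hreg hconn a b
  have hR0 : 0 ≤ effectiveResistance (G.adjMatrix ℝ) a b := by
    rcases eq_or_ne a b with rfl | hab
    · rw [effectiveResistance_self]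
    · exact (effectiveResistance_pos hc hirr hab).le
  have hn : (0 : ℝ) ≤ Fintype.card V := Nat.cast_nonneg _
  have hdR : (1 : ℝ) ≤ d := by exact_mod_cast hd
  have hnd : (0 : ℝ) ≤ (Fintype.card V : ℝ) * d := by positivity
  calc effectiveResistance (G.adjMatrix ℝ) a b * ((Fintype.card V : ℝ) * d)
      ≤ (3 * (Fintype.card V : ℝ) / d - 1) * ((Fintype.card V : ℝ) * d) :=
        mul_le_mul_of_nonneg_right (hR.trans hD) hnd
    _ = 3 * (Fintype.card V : ℝ) ^ 2 - (Fintype.card V : ℝ) * d := by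
        field_simp

end RegularCommute

end Literature.Probability.MarkovChains
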